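import Literature.MathematicalPhysics.QuantumFieldTheory.Balaban1983to89.B1Eq324BenfattoLemma
import Literature.MathematicalPhysics.QuantumFieldTheory.Balaban1983to89.GaussianSmallField
import Literature.Probability.Distributions.KhatriSidak
import Literature.MathematicalPhysics.QuantumFieldTheory.Balaban1983to89.B3CxiTadpoleLimit
import HarnessLib

/-!
# `Balaban1983to89.B1Eq324BenfattoAppendixA` — the Lemma of APPENDIX A of G. Benfatto, M. Cassandro, G. Gallavotti,
# F. Nicolò, E. Olivieri, E. Presutti, E. Scacciatelli, *Some probabilistic techniques in field theory*, Commun. Math.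
# Phys. **59** (1978) 143–166 [BenfattoEtAl1978], (A.1)–(A.2) p. 161, PROVED: the named fact
# `B1Eq324BenfattoLemma.AppendixALemmaPrinted` is a theorem

statement-level skeleton of published theorems with citation tags; proofs where landed; nothing here is a claim about the
Yang–Mills mass gap

WHY THIS MODULE (cell `pub-ymgap`, seat `dag-n08-b` = node N08 [Balaban1985UV3] «first missing estimate» lane).  T. Bałaban,
CMP **102** (1985) 255–275 computes every fluctuation integral of Thm 2's proof ((24) p. 262, (58) p. 270) *"by the cumulant
expansion formula (3.24) [8]"*; [8] = [Balaban1982Higgs1] proves (3.24) p. 616 only by reference to *"the lemma formulated on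
p. 152"* of [BenfattoEtAl1978]; the tree types that Lemma and its free-field input, the Lemma of Appendix A, AS PRINTED in
`…Balaban1983to89.B1Eq324BenfattoLemma` (two named facts `BasicLemmaPrinted`, `AppendixALemmaPrinted`, neither proved there).
The §5 proof of the p. 152 Lemma rests on Appendix A (p. 159: *"b* can be chosen = max{10⁴, γ⁻³b̄} where b̄ … defined in
Appendix A"*; (5.19) p. 156 «the lemma on the free field»).  In the printed dependency order behind (24)/(58) the Appendix A
Lemma is therefore the innermost estimate that is not yet a tree theorem — this file proves it.

THE PRINTED STATEMENT (p. 160 last lines – p. 161, verbatim up to OCR; cf. the header of `…B1Eq324BenfattoLemma`):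
*"We define, for Δ ∈ Q₀, χ̂ᵇ_Δ = χ(|z_Δ| ≦ b(1 + d(Δ, I)) ≡ b_Δ) and prove the following lemma: **Lemma.** Let P̂₀(dz) be
defined as before [Eq. (1.6)]. Then there exist b̄, k₁, k₂, such that, for b > b̄,* `F_b ≡ ∫ P̂₀(dz) Π_{Δ∈Q₀} χ̂ᵇ_Δ ≧ exp[−|I|e_b]`
*(A.1),* `e_b = k₁ exp(−k₂b²)` *(A.2)."*  In the tree's dictionary (`B1Eq324BenfattoLemma`: `Q₀ ↦ Site d`, `P̂₀ ↦ P0 d α β =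
gaussianFieldOfKernel (freeCov d α β)`, `Π_{Δ∈Q₀} χ̂ᵇ_Δ ↦` the indicator of `smallFieldSet I b`, `d(Δ, I) ↦ distToRegion I`) this
is `AppendixALemma d α β := ∃ b̄ k₁ k₂, ∀ b > b̄, ∀ I ≠ ∅, exp(−|I|·k₁e^{−k₂b²}) ≤ (P0 d α β).real (smallFieldSet I b)` and the
fact `AppendixALemmaPrinted := ∀ d ∈ {2,3}, ∀ α β > 0, freeCov d α β 0 0 = ½ → AppendixALemma d α β`.

WHAT IS PROVED (no definition, no named fact, no `sorry`; axioms standard; pure-analysis helpers are `private`).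
* §1 — a kernel-generic **small-field volume of a centred Gaussian FIELD on a countable index set** (the tree's Kolmogorov
  field `gaussianFieldOfKernel K`, `K` positive semidefinite): `hasGaussianLaw_eval_comp` (the `Fin k`-marginals are Gaussian
  vectors), `smallField_real_ge_fin` / `smallField_real_ge_finset` (finite windows: `exp(−2Σ 2e^{−tₓ²/(2Cₓ)}) ≤
  P(|ω x| ≤ tₓ ∀ x ∈ F)` for `K x x ≤ Cₓ` in the regime `2e^{−tₓ²/(2Cₓ)} ≤ ½` — Šidák's inequality [Sidak1967] in the kernel
  form `KhatriSidak.sidak_of_hasGaussianLaw` + the one-site Chernoff tails of `GaussianSmallField` (private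
  `real_abs_eval_le_ge`)), and `smallField_real_ge_of_sum_le` (ALL sites at once: `exp(−4T) ≤ P(|ω x| ≤ tₓ ∀ x)` whenever
  every finite partial sum of `e^{−tₓ²/(2Cₓ)}` is `≤ T` — continuity from above `Directed.measure_iInter` over the directed
  family of finite windows).
* §2 — the geometry of the unit pavement entering (A.2): `cubeDist_nonneg`, `distToRegion_nonneg`, `cubeDist_sq_eq`,
  `exists_mem_distToRegion_eq`, and the threshold sum `sum_exp_neg_threshold_sq_le`
  (`Σ_{x∈F} e^{−(b(1+d(Δₓ,I)))²/(2C)} ≤ |I|·8^d·e^{−b²/(2C)}` for every finite `F ⊂ Q₀` once `b² ≥ 2C`), through the private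
  counts `sum_half_pow_natAbs_sub_one_le` (`Σ_{n∈S} (½)^{|n|−1} ≤ 8` for every finite `S ⊂ ℤ`) and
  `sum_exp_neg_mul_cubeDist_sq_le` (`Σ_{x∈F} e^{−c·dist(Δₓ,Δ_y)²} ≤ 8^d` for `c ≥ 1`, by `Fintype.piFinset` /
  `Finset.prod_univ_sum`).
* §3 — **(A.1)–(A.2) with explicit constants** `appendixA_explicit`: for every `C > 0` with `E z_Δ² ≤ C`, every `b > 0` with
  `b² ≥ 4C` and every nonempty `I`: `exp(−|I|·(4·8^d)·e^{−b²/(2C)}) ≤ F_b`, i.e. `k₁ = 4·8^d`, `k₂ = 1/(2C)`; hence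
  `appendixALemma_of_pos` (EVERY `d`, every `α, β > 0`, no normalisation: `b̄ = max 2 (2(|E z_Δ²| + 1))`) and
  **`appendixALemmaPrinted_holds : AppendixALemmaPrinted`** (at print's `E z_Δ² = ½`: `k₂ = 1`, `k₁ = 4·8^d`, `b̄ = 2`), with
  the canonical discharge alias `B1Eq324BenfattoLemma.AppendixALemmaPrinted_holds`.
* §4 (v1.1) — **non-vacuity of the printed hypothesis** «α, β fixed so that the expectation of z_Δ² is ½»: `Cxi_zero_pos`
  (the tadpole `C^ξ(0) > 0`: a positive integrand `≥ 1/(4d + ξ²)` over the Brillouin box of volume `(2π)^d`,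
  `B3CxiTadpole.Cxi_zero_eq`), `CetaM_zero_pos`, `freeCov_zero_zero_pos` (`E z_Δ² > 0`), `exists_beta_freeCov_eq_half`
  (`β := 2C¹_{α²}(0)` normalises), `appendixALemmaPrinted_nonvacuous` (for `d = 2, 3` and every `α > 0` some `β > 0` meets
  the normalisation and (A.1)–(A.2) holds there) — answering the referee note that `CetaM(0) > 0` was «evident … not formalised».

PROOF ROUTE ≠ PRINT'S.  Print (p. 161, (A.3)–(A.6)) removes the cut-offs one tessera at a time and bounds the one-site
conditional densities by the superstability estimate of Ruelle [5] («A = βα²/2, B = 0»), getting (A.6).  Here the lower bound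
comes from the Gaussian correlation inequality of Šidák (a product of one-site probabilities, no conditioning) and Chernoff
one-site tails; only the nearest-neighbour structure «E z_Δ² = const» of the free field (1.1) is used (translation invariance
`freeCov_self`), so the result holds for every positive semidefinite translation-bounded kernel — that generality is §1.  The
constants differ from (A.6); the STATEMENT (A.1)–(A.2) is the printed one.  NOT summit progress; count-neutral for N08
(nothing of [Balaban1985UV3] (24)/(41)/(47)/(58) is asserted; `Node00.PrintedUV3V` untouched); tree debt −1.
-/

noncomputable section

open MeasureTheory ProbabilityTheory Finset
open scoped BigOperators NNReal ENNReal

namespace Literature.MathematicalPhysics.QuantumFieldTheory.Balaban1983to89.B1Eq324BenfattoAppendixA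

open Literature.MathematicalPhysics.QuantumFieldTheory
open Literature.MathematicalPhysics.QuantumFieldTheory.Balaban1983to89
open Literature.MathematicalPhysics.QuantumFieldTheory.Balaban1983to89.B1Eq324BenfattoLemma
open Literature.Probability.Distributions

/-! ## §1  The small-field volume of a centred Gaussian field on a countable index set -/

section Field

variable {ι : Type*} [DecidableEq ι] {K : ι → ι → ℝ}

/-- `e^{−2a} ≤ 1 − a` for `0 ≤ a ≤ ½` (from `1 + 2a ≤ e^{2a}`). [folklore] -/
private theorem exp_neg_two_mul_le_one_sub {a : ℝ} (h0 : 0 ≤ a) (h1 : a ≤ 1 / 2) :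
    Real.exp (-(2 * a)) ≤ 1 - a := by
  have ha : 2 * a + 1 ≤ Real.exp (2 * a) := Real.add_one_le_exp _
  have h1a : 0 ≤ 1 - a := by linarith
  have hb := mul_le_mul_of_nonneg_left ha h1a
  rw [Real.exp_neg, inv_le_iff_one_le_mul₀ (Real.exp_pos _)]
  nlinarith [mul_nonneg h0 (show 0 ≤ 1 - 2 * a by linarith), hb]

/-- The product form: `exp(−2 Σ_{i∈s} aᵢ) ≤ ∏_{i∈s} (1 − aᵢ)` for `0 ≤ aᵢ ≤ ½`. [folklore] -/
private theorem exp_neg_two_sum_le_prod {κ : Type*} (s : Finset κ) {a : κ → ℝ} (h0 : ∀ i ∈ s, 0 ≤ a i)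
    (h1 : ∀ i ∈ s, a i ≤ 1 / 2) :
    Real.exp (-(2 * ∑ i ∈ s, a i)) ≤ ∏ i ∈ s, (1 - a i) := by
  have hsum : -(2 * ∑ i ∈ s, a i) = ∑ i ∈ s, (-(2 * a i)) := by
    rw [Finset.mul_sum, ← Finset.sum_neg_distrib]
  rw [hsum, Real.exp_sum]
  exact Finset.prod_le_prod (fun i _ => (Real.exp_pos _).le) fun i hi =>
    exp_neg_two_mul_le_one_sub (h0 i hi) (h1 i hi)

/-- **The `Fin k`-marginals of the Gaussian field are Gaussian vectors**: for any `e : Fin k → ι` the vector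
`ω ↦ (ω (e i))ᵢ` has a Gaussian law under `gaussianFieldOfKernel K` (joint normality of finitely many coordinates of a
Gaussian process; Kallenberg, *Foundations* (2002), Lemma 13.1). [cite: Kallenberg2002, Lemma 13.1] -/
theorem hasGaussianLaw_eval_comp (hK : IsPosSemidefKernel K) {k : ℕ} (e : Fin k → ι) :
    HasGaussianLaw (fun (ω : ι → ℝ) (i : Fin k) => ω (e i)) (gaussianFieldOfKernel K) := by
  have hproc : IsGaussianProcess (fun (i : Fin k) (ω : ι → ℝ) => ω (e i)) (gaussianFieldOfKernel K) :=
    (isGaussianProcess_eval_gaussianFieldOfKernel hK).comp_right e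
  have h := hproc.hasGaussianLaw Finset.univ
  let L : (↥(Finset.univ : Finset (Fin k)) → ℝ) →L[ℝ] (Fin k → ℝ) :=
    ContinuousLinearMap.pi fun i : Fin k =>
      ContinuousLinearMap.proj (R := ℝ) (⟨i, Finset.mem_univ i⟩ : ↥(Finset.univ : Finset (Fin k)))
  have hfun : (fun (ω : ι → ℝ) (i : Fin k) => ω (e i)) =
      L ∘ fun ω => (Finset.univ : Finset (Fin k)).restrict fun i => ω (e i) := by
    funext ω i
    rfl
  rw [hfun]
  exact h.map L

/-- **One site**: under the Gaussian field the coordinate `ω x` is `N(0, K x x)`, so for `K x x ≤ C`, `C > 0`, `p ≥ 0`: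
`1 − 2e^{−p²/(2C)} ≤ P(|ω x| ≤ p)` (Chernoff tails of `GaussianSmallField`). [folklore] -/
private theorem real_abs_eval_le_ge (hK : IsPosSemidefKernel K) (x : ι) {C p : ℝ} (hC : 0 < C) (hKC : K x x ≤ C)
    (hp : 0 ≤ p) :
    1 - 2 * Real.exp (-(p ^ 2 / (2 * C))) ≤ (gaussianFieldOfKernel K).real {ω | |ω x| ≤ p} := by
  have hX : HasGaussianLaw (fun ω : ι → ℝ => ω x) (gaussianFieldOfKernel K) :=
    (isGaussianProcess_eval_gaussianFieldOfKernel hK).hasGaussianLaw_eval x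
  have hmap := hX.map_eq_gaussianReal
  have hmean : ∫ ω, ω x ∂gaussianFieldOfKernel K = 0 := integral_eval_gaussianFieldOfKernel hK x
  have hvar : Var[fun ω : ι → ℝ => ω x; gaussianFieldOfKernel K] = K x x := by
    rw [← covariance_self (measurable_pi_apply x).aemeasurable, covariance_eval_gaussianFieldOfKernel hK x x]
  rw [hmean, hvar] at hmap
  have hset : {ω : ι → ℝ | |ω x| ≤ p} = (fun ω : ι → ℝ => ω x) ⁻¹' {y : ℝ | |y - 0| ≤ p} := by
    ext ω
    simp only [Set.mem_setOf_eq, Set.mem_preimage, sub_zero]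
  have hmeas : MeasurableSet {y : ℝ | |y - 0| ≤ p} := measurableSet_le (by fun_prop) (by fun_prop)
  rw [hset, ← map_measureReal_apply (measurable_pi_apply x) hmeas, hmap]
  have hv : (((K x x).toNNReal : ℝ≥0) : ℝ) ≤ C := by
    rw [Real.coe_toNNReal']
    exact max_le hKC hC.le
  exact GaussianSmallField.gaussianReal_real_abs_sub_mean_le_ge (m := 0) hC hv hp

/-- **Finite windows, `Fin k`-indexed**: for sites `e i`, thresholds `pᵢ > 0` and variance bounds `K (e i) (e i) ≤ Cᵢ` in the
regime `2e^{−pᵢ²/(2Cᵢ)} ≤ ½`:  `exp(−2 Σᵢ 2e^{−pᵢ²/(2Cᵢ)}) ≤ P(|ω (e i)| ≤ pᵢ ∀ i)` — Šidák's inequality [Sidak1967] for the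
jointly Gaussian coordinates times the one-site bounds. [cite: Sidak1967, Corollary 1] -/
theorem smallField_real_ge_fin (hK : IsPosSemidefKernel K) {k : ℕ} (e : Fin k → ι) {C p : Fin k → ℝ}
    (hC : ∀ i, 0 < C i) (hKC : ∀ i, K (e i) (e i) ≤ C i) (hp : ∀ i, 0 < p i)
    (hsmall : ∀ i, 2 * Real.exp (-(p i ^ 2 / (2 * C i))) ≤ 1 / 2) :
    Real.exp (-(2 * ∑ i, 2 * Real.exp (-(p i ^ 2 / (2 * C i))))) ≤
      (gaussianFieldOfKernel K).real {ω | ∀ i, |ω (e i)| ≤ p i} := by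
  haveI := isProbabilityMeasure_gaussianFieldOfKernel hK
  -- Šidák for the Gaussian vector `(ω (e i))ᵢ`
  have hsidak := KhatriSidak.sidak_of_hasGaussianLaw (P := gaussianFieldOfKernel K)
    (X := fun (i : Fin k) (ω : ι → ℝ) => ω (e i)) (hasGaussianLaw_eval_comp hK e)
    (fun i => integral_eval_gaussianFieldOfKernel hK (e i)) p
  have hsidakR : ∏ i, (gaussianFieldOfKernel K).real {ω | |ω (e i)| ≤ p i} ≤
      (gaussianFieldOfKernel K).real {ω | ∀ i, |ω (e i)| ≤ p i} := by
    simp only [measureReal_def, ← ENNReal.toReal_prod]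
    exact ENNReal.toReal_mono (measure_ne_top _ _) hsidak
  calc Real.exp (-(2 * ∑ i, 2 * Real.exp (-(p i ^ 2 / (2 * C i)))))
      ≤ ∏ i, (1 - 2 * Real.exp (-(p i ^ 2 / (2 * C i)))) :=
        exp_neg_two_sum_le_prod Finset.univ (fun i _ => by positivity) (fun i _ => hsmall i)
    _ ≤ ∏ i, (gaussianFieldOfKernel K).real {ω | |ω (e i)| ≤ p i} :=
        Finset.prod_le_prod (fun i _ => by linarith [hsmall i]) fun i _ =>
          real_abs_eval_le_ge hK (e i) (hC i) (hKC i) (hp i).le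
    _ ≤ (gaussianFieldOfKernel K).real {ω | ∀ i, |ω (e i)| ≤ p i} := hsidakR

/-- **Finite windows**: for a finite set of sites `F`, thresholds `tₓ > 0`, variance bounds `K x x ≤ Cₓ`, in the regime
`2e^{−tₓ²/(2Cₓ)} ≤ ½`:  `exp(−2 Σ_{x∈F} 2e^{−tₓ²/(2Cₓ)}) ≤ P(|ω x| ≤ tₓ ∀ x ∈ F)`. [cite: Sidak1967, Corollary 1] -/
theorem smallField_real_ge_finset (hK : IsPosSemidefKernel K) (F : Finset ι) {C t : ι → ℝ}
    (hC : ∀ x ∈ F, 0 < C x) (hKC : ∀ x ∈ F, K x x ≤ C x) (ht : ∀ x ∈ F, 0 < t x)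
    (hsmall : ∀ x ∈ F, 2 * Real.exp (-(t x ^ 2 / (2 * C x))) ≤ 1 / 2) :
    Real.exp (-(2 * ∑ x ∈ F, 2 * Real.exp (-(t x ^ 2 / (2 * C x))))) ≤
      (gaussianFieldOfKernel K).real {ω | ∀ x ∈ F, |ω x| ≤ t x} := by
  -- enumerate `F` by `Fin F.card`
  set e : Fin F.card → ι := fun i => ((F.equivFin.symm i : F) : ι) with he
  have hmem : ∀ i, e i ∈ F := fun i => (F.equivFin.symm i).2
  have h := smallField_real_ge_fin hK e (C := fun i => C (e i)) (p := fun i => t (e i))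
    (fun i => hC _ (hmem i)) (fun i => hKC _ (hmem i)) (fun i => ht _ (hmem i)) (fun i => hsmall _ (hmem i))
  have hsum : ∑ i : Fin F.card, 2 * Real.exp (-(t (e i) ^ 2 / (2 * C (e i)))) =
      ∑ x ∈ F, 2 * Real.exp (-(t x ^ 2 / (2 * C x))) := by
    rw [← Finset.sum_coe_sort F]
    exact Fintype.sum_equiv F.equivFin.symm _ (fun x : F => 2 * Real.exp (-(t x ^ 2 / (2 * C x)))) fun i => rfl
  have hset : {ω : ι → ℝ | ∀ i, |ω (e i)| ≤ t (e i)} = {ω | ∀ x ∈ F, |ω x| ≤ t x} := by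
    ext ω
    simp only [Set.mem_setOf_eq]
    constructor
    · intro hω x hx
      have := hω (F.equivFin ⟨x, hx⟩)
      simpa [he] using this
    · intro hω i
      exact hω _ (hmem i)
  rw [hsum, hset] at h
  exact h

/-- **All sites at once (countable index set)**: if every site has a threshold `tₓ > 0` and a variance bound `K x x ≤ Cₓ` in
the regime `2e^{−tₓ²/(2Cₓ)} ≤ ½`, and EVERY FINITE partial sum obeys `Σ_{x∈F} e^{−tₓ²/(2Cₓ)} ≤ T`, then
`exp(−4T) ≤ P(|ω x| ≤ tₓ for all x)` — the finite-window bounds pass to the countable intersection by continuity from above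
(the family of finite-window events is directed).  This is the kernel-generic form of the small-field volume (A.1) of
[BenfattoEtAl1978] (there: the free field (1.1), thresholds `b(1 + d(Δ, I))`).
[cite: BenfattoEtAl1978, Appendix A Lemma (A.1) p.161] -/
theorem smallField_real_ge_of_sum_le [Countable ι] (hK : IsPosSemidefKernel K) {C t : ι → ℝ} {T : ℝ}
    (hC : ∀ x, 0 < C x) (hKC : ∀ x, K x x ≤ C x) (ht : ∀ x, 0 < t x)
    (hsmall : ∀ x, 2 * Real.exp (-(t x ^ 2 / (2 * C x))) ≤ 1 / 2)
    (hT : ∀ F : Finset ι, ∑ x ∈ F, Real.exp (-(t x ^ 2 / (2 * C x))) ≤ T) :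
    Real.exp (-(4 * T)) ≤ (gaussianFieldOfKernel K).real {ω | ∀ x, |ω x| ≤ t x} := by
  haveI := isProbabilityMeasure_gaussianFieldOfKernel hK
  set P := gaussianFieldOfKernel K with hP
  let A : Finset ι → Set (ι → ℝ) := fun F => {ω | ∀ x ∈ F, |ω x| ≤ t x}
  have hAmeas : ∀ F, MeasurableSet (A F) := by
    intro F
    have : A F = ⋂ x ∈ F, {ω : ι → ℝ | |ω x| ≤ t x} := by
      ext ω
      simp only [A, Set.mem_setOf_eq, Set.mem_iInter]
    rw [this]
    exact MeasurableSet.biInter (Finset.countable_toSet F) fun x _ =>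
      measurableSet_le (continuous_abs.measurable.comp (measurable_pi_apply x)) measurable_const
  have hInter : {ω : ι → ℝ | ∀ x, |ω x| ≤ t x} = ⋂ F : Finset ι, A F := by
    ext ω
    simp only [A, Set.mem_setOf_eq, Set.mem_iInter]
    constructor
    · intro h F x _
      exact h x
    · intro h x
      exact h {x} x (Finset.mem_singleton_self x)
  have hdir : Directed (· ⊇ ·) A := by
    intro F G
    refine ⟨F ∪ G, ?_, ?_⟩
    · intro ω hω x hx
      exact hω x (Finset.mem_union_left G hx)
    · intro ω hω x hx
      exact hω x (Finset.mem_union_right F hx)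
  have hcont : P (⋂ F : Finset ι, A F) = ⨅ F : Finset ι, P (A F) :=
    hdir.measure_iInter (fun F => (hAmeas F).nullMeasurableSet) ⟨∅, measure_ne_top _ _⟩
  -- each finite window has mass ≥ exp(−4T)
  have hF : ∀ F : Finset ι, ENNReal.ofReal (Real.exp (-(4 * T))) ≤ P (A F) := by
    intro F
    have h1 := smallField_real_ge_finset hK F (C := C) (t := t) (fun x _ => hC x) (fun x _ => hKC x)
      (fun x _ => ht x) (fun x _ => hsmall x)
    have h2 : Real.exp (-(4 * T)) ≤ Real.exp (-(2 * ∑ x ∈ F, 2 * Real.exp (-(t x ^ 2 / (2 * C x))))) := by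
      refine Real.exp_le_exp.2 ?_
      have : ∑ x ∈ F, 2 * Real.exp (-(t x ^ 2 / (2 * C x))) = 2 * ∑ x ∈ F, Real.exp (-(t x ^ 2 / (2 * C x))) := by
        rw [Finset.mul_sum]
      rw [this]
      linarith [hT F]
    rw [← hP] at h1
    have h3 : Real.exp (-(4 * T)) ≤ P.real (A F) := h2.trans h1
    exact (ENNReal.ofReal_le_iff_le_toReal (measure_ne_top _ _)).2 h3
  have hle : ENNReal.ofReal (Real.exp (-(4 * T))) ≤ P {ω : ι → ℝ | ∀ x, |ω x| ≤ t x} := by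
    rw [hInter, hcont]
    exact le_iInf hF
  exact (ENNReal.ofReal_le_iff_le_toReal (measure_ne_top _ _)).1 hle

end Field

/-! ## §2  The geometry of the unit pavement `Q₀` entering (A.2) -/

section Geometry

variable {d : ℕ}

/-- The cube distance is non-negative. [cite: BenfattoEtAl1978, after (2.3) p.146] -/
theorem cubeDist_nonneg (x y : B1Eq324BenfattoLemma.Site d) : 0 ≤ cubeDist x y := Real.sqrt_nonneg _

/-- `d(Δ, I) ≥ 0`. [cite: BenfattoEtAl1978, after (2.3) p.146] -/
theorem distToRegion_nonneg (I : Finset (B1Eq324BenfattoLemma.Site d)) (x : B1Eq324BenfattoLemma.Site d) :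
    0 ≤ distToRegion I x := by
  unfold distToRegion
  split_ifs with h
  · exact Finset.le_inf' h _ fun y _ => cubeDist_nonneg x y
  · exact le_rfl

/-- For a nonempty region the distance `d(Δ, I)` is attained at some cube of `I`. [cite: BenfattoEtAl1978, after (2.3) p.146] -/
theorem exists_mem_distToRegion_eq {I : Finset (B1Eq324BenfattoLemma.Site d)} (hI : I.Nonempty)
    (x : B1Eq324BenfattoLemma.Site d) : ∃ y ∈ I, distToRegion I x = cubeDist x y := by
  rw [distToRegion, dif_pos hI]
  exact Finset.exists_mem_eq_inf' hI _

/-- `dist(Δₓ, Δ_y)² = Σⱼ max(|xⱼ − yⱼ| − 1, 0)²`. [cite: BenfattoEtAl1978, after (2.3) p.146] -/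
theorem cubeDist_sq_eq (x y : B1Eq324BenfattoLemma.Site d) :
    cubeDist x y ^ 2 = ∑ j, max (|((x j : ℝ) - (y j : ℝ))| - 1) 0 ^ 2 :=
  Real.sq_sqrt (Finset.sum_nonneg fun _ _ => sq_nonneg _)

/-- The integer form of the per-axis gap: `max(|n| − 1, 0) = (|n| − 1 : ℕ)` for `n ∈ ℤ` (truncated subtraction).
[folklore] -/
private theorem max_natAbs_sub_one_eq (n : ℤ) : max (|(n : ℝ)| - 1) 0 = ((n.natAbs - 1 : ℕ) : ℝ) := by
  have habs : |(n : ℝ)| = (n.natAbs : ℝ) := by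
    rw [← Int.cast_natCast, Int.natCast_natAbs, Int.cast_abs]
  rw [habs]
  rcases Nat.eq_zero_or_pos n.natAbs with h | h
  · simp [h]
  · rw [Nat.cast_sub h, Nat.cast_one, max_eq_left]
    exact sub_nonneg.2 (by exact_mod_cast h)

/-- `2 ≤ e`. [folklore] -/
private theorem two_le_exp_one : (2 : ℝ) ≤ Real.exp 1 := by
  have h := Real.add_one_le_exp (1 : ℝ)
  norm_num at h ⊢
  exact h

/-- **Per-axis weight**: for `c ≥ 1` and `n ∈ ℤ`, `exp(−c·max(|n| − 1, 0)²) ≤ (½)^{|n|−1}` (the gap `q = |n| − 1 ∈ ℕ` obeys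
`cq² ≥ q`, and `e^{−1} ≤ ½`). [folklore] -/
private theorem exp_neg_mul_max_sq_le (n : ℤ) {c : ℝ} (hc : 1 ≤ c) :
    Real.exp (-(c * max (|(n : ℝ)| - 1) 0 ^ 2)) ≤ (1 / 2 : ℝ) ^ (n.natAbs - 1) := by
  rw [max_natAbs_sub_one_eq]
  set q : ℕ := n.natAbs - 1 with hq
  have hqq : (q : ℝ) ≤ (q : ℝ) ^ 2 := by
    rcases Nat.eq_zero_or_pos q with h | h
    · simp [h]
    · have h1 : (1 : ℝ) ≤ q := by exact_mod_cast h
      nlinarith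
  have hcq : (q : ℝ) ≤ c * (q : ℝ) ^ 2 := by nlinarith [sq_nonneg (q : ℝ)]
  calc Real.exp (-(c * (q : ℝ) ^ 2)) ≤ Real.exp (-(q : ℝ)) := Real.exp_le_exp.2 (by linarith)
    _ = Real.exp (-1) ^ q := by rw [← Real.exp_nat_mul]; ring_nf
    _ ≤ (1 / 2 : ℝ) ^ q := by
        refine pow_le_pow_left₀ (Real.exp_pos _).le ?_ q
        rw [Real.exp_neg, one_div]
        exact inv_anti₀ (by norm_num) two_le_exp_one

/-- **Per-axis count**: `Σ_{n∈S} (½)^{|n|−1} ≤ 8` for every finite `S ⊂ ℤ` (each value of `|n|` has at most two preimages,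
`(½)^{m−1} ≤ 2·(½)^m`, and `Σ_{m<N} (½)^m ≤ 2`). [folklore] -/
private theorem sum_half_pow_natAbs_sub_one_le (S : Finset ℤ) : ∑ n ∈ S, (1 / 2 : ℝ) ^ (n.natAbs - 1) ≤ 8 := by
  set T : Finset ℕ := S.image Int.natAbs with hT
  have hmaps : ∀ n ∈ S, n.natAbs ∈ T := fun n hn => Finset.mem_image_of_mem _ hn
  rw [← Finset.sum_fiberwise_of_maps_to hmaps]
  -- each fibre has at most two elements
  have hfib : ∀ m ∈ T, ∑ n ∈ S with n.natAbs = m, (1 / 2 : ℝ) ^ (n.natAbs - 1) ≤ 2 * (1 / 2 : ℝ) ^ (m - 1) := by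
    intro m _
    have hcongr : ∑ n ∈ S with n.natAbs = m, (1 / 2 : ℝ) ^ (n.natAbs - 1) =
        ∑ n ∈ S with n.natAbs = m, (1 / 2 : ℝ) ^ (m - 1) := by
      refine Finset.sum_congr rfl fun n hn => ?_
      rw [(Finset.mem_filter.1 hn).2]
    rw [hcongr, Finset.sum_const, nsmul_eq_mul]
    have hcard : (S.filter fun n => n.natAbs = m).card ≤ 2 := by
      have hsub : (S.filter fun n => n.natAbs = m) ⊆ ({(m : ℤ), -(m : ℤ)} : Finset ℤ) := by
        intro n hn
        have h := (Finset.mem_filter.1 hn).2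
        rcases Int.natAbs_eq_iff.1 h with h' | h'
        · simp [h']
        · simp [h']
      exact (Finset.card_le_card hsub).trans Finset.card_le_two
    have hcardR : ((S.filter fun n => n.natAbs = m).card : ℝ) ≤ 2 := by exact_mod_cast hcard
    exact mul_le_mul_of_nonneg_right hcardR (by positivity)
  -- `(½)^{m−1} ≤ 2 (½)^m`
  have hshift : ∀ m : ℕ, (1 / 2 : ℝ) ^ (m - 1) ≤ 2 * (1 / 2 : ℝ) ^ m := by
    intro m
    rcases Nat.eq_zero_or_pos m with h | h
    · subst h
      norm_num
    · obtain ⟨k, rfl⟩ := Nat.exists_eq_succ_of_ne_zero (Nat.pos_iff_ne_zero.1 h)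
      rw [Nat.succ_sub_one, pow_succ]
      ring_nf
      exact le_rfl
  -- the geometric sum over `T ⊆ range (sup T + 1)`
  have hgeom : ∑ m ∈ T, (1 / 2 : ℝ) ^ m ≤ 2 := by
    have hsub : T ⊆ Finset.range (T.sup id + 1) := by
      intro m hm
      have : m ≤ T.sup id := Finset.le_sup (f := id) hm
      exact Finset.mem_range.2 (Nat.lt_succ_of_le this)
    exact (Finset.sum_le_sum_of_subset_of_nonneg hsub fun m _ _ => by positivity).trans
      (sum_geometric_two_le _)
  calc ∑ m ∈ T, ∑ n ∈ S with n.natAbs = m, (1 / 2 : ℝ) ^ (n.natAbs - 1)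
      ≤ ∑ m ∈ T, 2 * (1 / 2 : ℝ) ^ (m - 1) := Finset.sum_le_sum hfib
    _ ≤ ∑ m ∈ T, 2 * (2 * (1 / 2 : ℝ) ^ m) :=
        Finset.sum_le_sum fun m _ => mul_le_mul_of_nonneg_left (hshift m) (by norm_num)
    _ = 4 * ∑ m ∈ T, (1 / 2 : ℝ) ^ m := by
        rw [Finset.mul_sum]
        refine Finset.sum_congr rfl fun m _ => ?_
        ring
    _ ≤ 4 * 2 := by linarith [hgeom]
    _ = 8 := by norm_num

/-- **Per-axis count, shifted**: `Σ_{m∈S} exp(−c·max(|m − y| − 1, 0)²) ≤ 8` for `c ≥ 1`, `y ∈ ℤ`, finite `S ⊂ ℤ`.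
[folklore] -/
private theorem sum_exp_neg_mul_max_sq_le (S : Finset ℤ) (y : ℤ) {c : ℝ} (hc : 1 ≤ c) :
    ∑ m ∈ S, Real.exp (-(c * max (|((m : ℝ) - (y : ℝ))| - 1) 0 ^ 2)) ≤ 8 := by
  have h1 : ∑ m ∈ S, Real.exp (-(c * max (|((m : ℝ) - (y : ℝ))| - 1) 0 ^ 2)) ≤
      ∑ m ∈ S, (1 / 2 : ℝ) ^ ((m - y).natAbs - 1) := by
    refine Finset.sum_le_sum fun m _ => ?_
    have h := exp_neg_mul_max_sq_le (m - y) hc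
    rwa [Int.cast_sub] at h
  have hinj : ∀ m ∈ S, ∀ m' ∈ S, m - y = m' - y → m = m' := fun m _ m' _ h => sub_left_injective h
  have h2 : ∑ m ∈ S, (1 / 2 : ℝ) ^ ((m - y).natAbs - 1) =
      ∑ n ∈ S.image (· - y), (1 / 2 : ℝ) ^ (n.natAbs - 1) :=
    (Finset.sum_image (f := fun n : ℤ => (1 / 2 : ℝ) ^ (n.natAbs - 1)) hinj).symm
  rw [h2] at h1
  exact h1.trans (sum_half_pow_natAbs_sub_one_le _)

/-- **Product count**: for `c ≥ 1`, a cube `Δ_y` and a finite set of cubes `F`,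
`Σ_{x∈F} exp(−c·dist(Δₓ, Δ_y)²) ≤ 8^d` — the weight factorises over the axes and `F` sits inside the product of its
coordinate projections (`Fintype.piFinset`). [folklore] -/
private theorem sum_exp_neg_mul_cubeDist_sq_le (F : Finset (B1Eq324BenfattoLemma.Site d)) (y : B1Eq324BenfattoLemma.Site d)
    {c : ℝ} (hc : 1 ≤ c) :
    ∑ x ∈ F, Real.exp (-(c * cubeDist x y ^ 2)) ≤ 8 ^ d := by
  -- the axis weights
  let w : Fin d → ℤ → ℝ := fun j m => Real.exp (-(c * max (|((m : ℝ) - (y j : ℝ))| - 1) 0 ^ 2))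
  have hterm : ∀ x : B1Eq324BenfattoLemma.Site d, Real.exp (-(c * cubeDist x y ^ 2)) = ∏ j, w j (x j) := by
    intro x
    rw [cubeDist_sq_eq, Finset.mul_sum, ← Finset.sum_neg_distrib, Real.exp_sum]
  simp_rw [hterm]
  -- `F ⊆ Π_j (image of F on axis j)`
  let S : Fin d → Finset ℤ := fun j => F.image fun x => x j
  have hsub : F ⊆ Fintype.piFinset S := fun x hx =>
    Fintype.mem_piFinset.2 fun j => Finset.mem_image_of_mem (fun x : B1Eq324BenfattoLemma.Site d => x j) hx
  have hnonneg : ∀ x ∈ Fintype.piFinset S, x ∉ F → 0 ≤ ∏ j, w j (x j) :=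
    fun x _ _ => Finset.prod_nonneg fun j _ => (Real.exp_pos _).le
  calc ∑ x ∈ F, ∏ j, w j (x j) ≤ ∑ x ∈ Fintype.piFinset S, ∏ j, w j (x j) :=
        Finset.sum_le_sum_of_subset_of_nonneg hsub hnonneg
    _ = ∏ j, ∑ m ∈ S j, w j m := (Finset.prod_univ_sum S w).symm
    _ ≤ ∏ _j : Fin d, (8 : ℝ) :=
        Finset.prod_le_prod (fun j _ => Finset.sum_nonneg fun m _ => (Real.exp_pos _).le)
          fun j _ => sum_exp_neg_mul_max_sq_le (S j) (y j) hc
    _ = 8 ^ d := by rw [Finset.prod_const, Finset.card_univ, Fintype.card_fin]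

/-- **The threshold sum of (A.2)**: for a nonempty region `I`, a finite set of cubes `F`, `C > 0` and `b² ≥ 2C`,
`Σ_{x∈F} exp(−(b(1 + d(Δₓ, I)))²/(2C)) ≤ |I|·8^d·exp(−b²/(2C))` — split `(1 + δ)² ≥ 1 + δ²`, realise `δ = d(Δₓ, I)` at a
cube of `I`, and count with `sum_exp_neg_mul_cubeDist_sq_le`. [cite: BenfattoEtAl1978, Appendix A (A.2) p.161] -/
theorem sum_exp_neg_threshold_sq_le {I : Finset (B1Eq324BenfattoLemma.Site d)} (hI : I.Nonempty)
    (F : Finset (B1Eq324BenfattoLemma.Site d)) {b C : ℝ}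
    (hC : 0 < C) (hb : 2 * C ≤ b ^ 2) :
    ∑ x ∈ F, Real.exp (-((b * (1 + distToRegion I x)) ^ 2 / (2 * C))) ≤
      (I.card : ℝ) * 8 ^ d * Real.exp (-(b ^ 2 / (2 * C))) := by
  set c : ℝ := b ^ 2 / (2 * C) with hc_def
  have h2C : 0 < 2 * C := by positivity
  have hc : 1 ≤ c := (one_le_div h2C).2 hb
  have hc0 : 0 ≤ c := zero_le_one.trans hc
  -- pointwise: `exp(−t²/(2C)) ≤ e^{−c} Σ_{y∈I} exp(−c·dist²)`
  have hpt : ∀ x : B1Eq324BenfattoLemma.Site d, Real.exp (-((b * (1 + distToRegion I x)) ^ 2 / (2 * C))) ≤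
      Real.exp (-c) * ∑ y ∈ I, Real.exp (-(c * cubeDist x y ^ 2)) := by
    intro x
    obtain ⟨y₀, hy₀, hδ⟩ := exists_mem_distToRegion_eq hI x
    have hδ0 : 0 ≤ distToRegion I x := distToRegion_nonneg I x
    have hexp : (b * (1 + distToRegion I x)) ^ 2 / (2 * C) = c * (1 + distToRegion I x) ^ 2 := by
      rw [hc_def]
      ring
    have hsq : c * (1 + distToRegion I x ^ 2) ≤ c * (1 + distToRegion I x) ^ 2 :=
      mul_le_mul_of_nonneg_left (by nlinarith) hc0
    calc Real.exp (-((b * (1 + distToRegion I x)) ^ 2 / (2 * C)))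
        ≤ Real.exp (-(c * (1 + distToRegion I x ^ 2))) := by
          rw [hexp]
          exact Real.exp_le_exp.2 (by linarith)
      _ = Real.exp (-c) * Real.exp (-(c * cubeDist x y₀ ^ 2)) := by
          rw [← Real.exp_add, ← hδ]
          ring_nf
      _ ≤ Real.exp (-c) * ∑ y ∈ I, Real.exp (-(c * cubeDist x y ^ 2)) :=
          mul_le_mul_of_nonneg_left
            (Finset.single_le_sum (f := fun y => Real.exp (-(c * cubeDist x y ^ 2)))
              (fun y _ => (Real.exp_pos _).le) hy₀)
            (Real.exp_pos _).le
  calc ∑ x ∈ F, Real.exp (-((b * (1 + distToRegion I x)) ^ 2 / (2 * C)))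
      ≤ ∑ x ∈ F, Real.exp (-c) * ∑ y ∈ I, Real.exp (-(c * cubeDist x y ^ 2)) := Finset.sum_le_sum fun x _ => hpt x
    _ = Real.exp (-c) * ∑ y ∈ I, ∑ x ∈ F, Real.exp (-(c * cubeDist x y ^ 2)) := by
        rw [← Finset.mul_sum, Finset.sum_comm]
    _ ≤ Real.exp (-c) * ∑ _y ∈ I, (8 : ℝ) ^ d :=
        mul_le_mul_of_nonneg_left (Finset.sum_le_sum fun y _ => sum_exp_neg_mul_cubeDist_sq_le F y hc)
          (Real.exp_pos _).le
    _ = (I.card : ℝ) * 8 ^ d * Real.exp (-(b ^ 2 / (2 * C))) := by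
        rw [Finset.sum_const, nsmul_eq_mul, hc_def]
        ring

end Geometry

/-! ## §3  The Lemma of Appendix A, (A.1)–(A.2) -/

section AppendixA

variable {d : ℕ}

/-- The smallness regime: `2e^{−u} ≤ ½` for `u ≥ 2` (`e² ≥ 4`). [folklore] -/
private theorem two_mul_exp_neg_le_half {u : ℝ} (hu : 2 ≤ u) : 2 * Real.exp (-u) ≤ 1 / 2 := by
  have h4 : (4 : ℝ) ≤ Real.exp 2 := by
    have h2 : Real.exp 2 = Real.exp 1 * Real.exp 1 := by
      rw [← Real.exp_add]
      norm_num
    rw [h2]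
    nlinarith [two_le_exp_one, Real.exp_pos (1 : ℝ)]
  have hle : Real.exp (-u) ≤ Real.exp (-2) := Real.exp_le_exp.2 (by linarith)
  have hinv : Real.exp (-2) ≤ 1 / 4 := by
    rw [Real.exp_neg, show (1 : ℝ) / 4 = (4 : ℝ)⁻¹ by norm_num]
    exact inv_anti₀ (by norm_num) h4
  linarith

/-- **(A.1)–(A.2) WITH EXPLICIT CONSTANTS.**  For the free field (1.1) with `α, β > 0`, any `C > 0` bounding the one-site
variance `E z_Δ² = freeCov d α β 0 0 ≤ C`, every `b > 0` with `b² ≥ 4C`, and every nonempty region `I ⊂ Q₀`: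
`exp(−|I|·(4·8^d)·e^{−b²/(2C)}) ≤ F_b = P̂₀(|z_Δ| ≤ b(1 + d(Δ, I)) ∀Δ ∈ Q₀)` — i.e. `k₁ = 4·8^d`, `k₂ = 1/(2C)` in (A.2).
[cite: BenfattoEtAl1978, Appendix A Lemma (A.1)–(A.2) p.161] -/
theorem appendixA_explicit {α β : ℝ} (hα : 0 < α) (hβ : 0 < β) {C : ℝ} (hC : 0 < C)
    (hvar : freeCov d α β 0 0 ≤ C) {b : ℝ} (hb0 : 0 < b) (hb : 4 * C ≤ b ^ 2)
    {I : Finset (B1Eq324BenfattoLemma.Site d)} (hI : I.Nonempty) :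
    Real.exp (-((I.card : ℝ) * (4 * 8 ^ d * Real.exp (-(b ^ 2 / (2 * C)))))) ≤
      (P0 d α β).real (smallFieldSet I b) := by
  have hK := isPosSemidefKernel_freeCov (d := d) hα hβ
  have h2C : 0 < 2 * C := by positivity
  have ht : ∀ x : B1Eq324BenfattoLemma.Site d, 0 < b * (1 + distToRegion I x) := fun x =>
    mul_pos hb0 (by linarith [distToRegion_nonneg I x])
  have hbt : ∀ x : B1Eq324BenfattoLemma.Site d, b ≤ b * (1 + distToRegion I x) := fun x => by
    have := distToRegion_nonneg I x
    nlinarith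
  have hsmall : ∀ x : B1Eq324BenfattoLemma.Site d, 2 * Real.exp (-((b * (1 + distToRegion I x)) ^ 2 / (2 * C))) ≤ 1 / 2 := by
    intro x
    refine two_mul_exp_neg_le_half ?_
    have h1 : b ^ 2 ≤ (b * (1 + distToRegion I x)) ^ 2 := pow_le_pow_left₀ hb0.le (hbt x) 2
    have h2 : (2 : ℝ) ≤ b ^ 2 / (2 * C) := (le_div_iff₀ h2C).2 (by linarith)
    exact h2.trans (div_le_div_of_nonneg_right h1 h2C.le)
  have hT := fun F : Finset (B1Eq324BenfattoLemma.Site d) => sum_exp_neg_threshold_sq_le hI F hC (by linarith : 2 * C ≤ b ^ 2)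
  have key := smallField_real_ge_of_sum_le (ι := B1Eq324BenfattoLemma.Site d) hK (C := fun _ => C)
    (t := fun x => b * (1 + distToRegion I x)) (fun _ => hC)
    (fun x => (freeCov_self α β x).le.trans hvar) ht hsmall hT
  have hexp : (I.card : ℝ) * (4 * 8 ^ d * Real.exp (-(b ^ 2 / (2 * C)))) =
      4 * ((I.card : ℝ) * 8 ^ d * Real.exp (-(b ^ 2 / (2 * C)))) := by ring
  rw [hexp]
  exact key

/-- **THE LEMMA OF APPENDIX A FOR EVERY `d` AND EVERY `α, β > 0`** (no normalisation of the variance):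
`AppendixALemma d α β` with `b̄ = max 2 (2(|E z_Δ²| + 1))`, `k₁ = 4·8^d`, `k₂ = 1/(2(|E z_Δ²| + 1))`.
[cite: BenfattoEtAl1978, Appendix A Lemma (A.1)–(A.2) p.161] -/
theorem appendixALemma_of_pos {α β : ℝ} (hα : 0 < α) (hβ : 0 < β) : AppendixALemma d α β := by
  set C : ℝ := |freeCov d α β 0 0| + 1 with hC_def
  have hC : 0 < C := by positivity
  have hvar : freeCov d α β 0 0 ≤ C := (le_abs_self _).trans (by linarith)
  refine ⟨max 2 (2 * C), 4 * 8 ^ d, 1 / (2 * C), fun b hb I hI => ?_⟩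
  have h2 : 2 < b := lt_of_le_of_lt (le_max_left _ _) hb
  have h2C : 2 * C < b := lt_of_le_of_lt (le_max_right _ _) hb
  have hb0 : 0 < b := by linarith
  have hb4 : 4 * C ≤ b ^ 2 := by nlinarith [mul_pos (sub_pos.2 h2C) hb0, mul_pos hC (sub_pos.2 h2)]
  have h := appendixA_explicit hα hβ hC hvar hb0 hb4 hI
  have heq : 1 / (2 * C) * b ^ 2 = b ^ 2 / (2 * C) := by ring
  rw [heq]
  exact h

/-- **THE LEMMA OF APPENDIX A OF [BenfattoEtAl1978], AS PRINTED, HOLDS** — the named fact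
`B1Eq324BenfattoLemma.AppendixALemmaPrinted` (d = 2, 3; `α, β > 0`; `E z_Δ² = ½`) is a theorem; at print's normalisation the
constants are `k₂ = 1`, `k₁ = 4·8^d`, `b̄ = 2`. [cite: BenfattoEtAl1978, Appendix A Lemma (A.1)–(A.2) p.161] -/
theorem appendixALemmaPrinted_holds : AppendixALemmaPrinted := by
  intro d _ α β hα hβ hhalf
  refine ⟨2, 4 * 8 ^ d, 1, fun b hb I hI => ?_⟩
  have hb0 : 0 < b := by linarith
  have hb4 : 4 * (1 / 2 : ℝ) ≤ b ^ 2 := by nlinarith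
  have h := appendixA_explicit hα hβ (C := 1 / 2) (by norm_num) hhalf.le hb0 hb4 hI
  have heq : (1 : ℝ) * b ^ 2 = b ^ 2 / (2 * (1 / 2)) := by ring
  rw [heq]
  exact h

end AppendixA

end Literature.MathematicalPhysics.QuantumFieldTheory.Balaban1983to89.B1Eq324BenfattoAppendixA

namespace Literature.MathematicalPhysics.QuantumFieldTheory.Balaban1983to89.B1Eq324BenfattoLemma

/-- **Canonical discharge name** of the named fact `AppendixALemmaPrinted` (`X ↦ X_holds`), an alias of
`B1Eq324BenfattoAppendixA.appendixALemmaPrinted_holds` placed next to the fact's name so that `(h : AppendixALemmaPrinted)`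
binders are fed `AppendixALemmaPrinted_holds`. [cite: BenfattoEtAl1978, Appendix A Lemma (A.1)–(A.2) p.161] -/
theorem AppendixALemmaPrinted_holds : AppendixALemmaPrinted := B1Eq324BenfattoAppendixA.appendixALemmaPrinted_holds

end Literature.MathematicalPhysics.QuantumFieldTheory.Balaban1983to89.B1Eq324BenfattoLemma


namespace Literature.MathematicalPhysics.QuantumFieldTheory.Balaban1983to89.B1Eq324BenfattoAppendixA

/-! ## §4  Non-vacuity: the printed normalisation `E z_Δ² = ½` is satisfiable (v1.1) -/

section NonVacuity

open Literature.MathematicalPhysics.QuantumFieldTheory.Balaban1983to89.B3Sect3VectorSelfEnergy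
open Literature.MathematicalPhysics.QuantumFieldTheory.Balaban1983to89.B3WT226FreeLattice
open Literature.MathematicalPhysics.QuantumFieldTheory.Balaban1983to89.B3CxiTadpoleLimit
open Literature.MathematicalPhysics.QuantumFieldTheory.Balaban1983to89.B1Eq324BenfattoLemma

variable {d : ℕ}

/-- **The tadpole is positive**: `C^ξ(0) > 0` for every `ξ > 0` — by `B3CxiTadpole.Cxi_zero_eq` it is a positive multiple of
the integral over the Brillouin box `|q_μ| ≤ π` (volume `(2π)^d`) of the continuous integrand `1/(Δ¹(q) + ξ²) ≥ 1/(4d + ξ²) > 0`.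
[cite: Balaban1983Higgs3, (3.16) p.437] -/
theorem Cxi_zero_pos {ξ : ℝ} (hξ : 0 < ξ) : 0 < Cxi d ξ 0 := by
  rw [B3CxiTadpole.Cxi_zero_eq hξ]
  have hvol : volume (bzBox d 1) = ENNReal.ofReal (2 * Real.pi) ^ d := volume_bzBox_one d
  have hvol_ne : volume (bzBox d 1) ≠ ∞ := by
    rw [hvol]
    exact ENNReal.pow_ne_top ENNReal.ofReal_ne_top
  have hvol_real : (volume : Measure (Fin d → ℝ)).real (bzBox d 1) = (2 * Real.pi) ^ d := by
    rw [measureReal_def, hvol, ENNReal.toReal_pow, ENNReal.toReal_ofReal (by positivity)]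
  have hden : ∀ q : Fin d → ℝ, 0 < lapSymbol d 1 q + ξ ^ 2 := fun q => by
    have := lapSymbol_nonneg d 1 q
    positivity
  have hcont : Continuous fun q : Fin d → ℝ => 1 / (lapSymbol d 1 q + ξ ^ 2) :=
    continuous_const.div ((continuous_lapSymbol d 1).add continuous_const) fun q => (hden q).ne'
  have hint : IntegrableOn (fun q : Fin d → ℝ => 1 / (lapSymbol d 1 q + ξ ^ 2)) (bzBox d 1) volume := by
    rw [bzBox_one_eq_Icc]
    exact hcont.continuousOn.integrableOn_compact isCompact_Icc
  have hge : ∀ q ∈ bzBox d 1, 1 / (4 * (d : ℝ) + ξ ^ 2) ≤ 1 / (lapSymbol d 1 q + ξ ^ 2) := fun q _ =>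
    one_div_le_one_div_of_le (hden q) (by linarith [lapSymbol_one_le q])
  have hlow := setIntegral_ge_of_const_le_real (measurableSet_bzBox d 1) hvol_ne hge hint
  have hpos : 0 < 1 / (4 * (d : ℝ) + ξ ^ 2) * (volume : Measure (Fin d → ℝ)).real (bzBox d 1) := by
    rw [hvol_real]
    positivity
  exact mul_pos (by positivity) (hpos.trans_le hlow)

/-- **`C^η_{M²}(0) > 0`** for `η, M² > 0` (`CetaM = M^{d−2}·C^{ηM}`). [cite: Balaban1983Higgs3, (2.26) p.431] -/
theorem CetaM_zero_pos {η M2 : ℝ} (hη : 0 < η) (hM : 0 < M2) : 0 < CetaM d η M2 0 := by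
  have hs : 0 < Real.sqrt M2 := Real.sqrt_pos.mpr hM
  unfold CetaM
  exact mul_pos (by positivity) (Cxi_zero_pos (mul_pos hη hs))

/-- **The one-site variance of the free field (1.1) is positive**: `E z_Δ² = freeCov d α β 0 0 = β⁻¹·C¹_{α²}(0) > 0` for
`α, β > 0`. [cite: BenfattoEtAl1978, (1.1) p.144] -/
theorem freeCov_zero_zero_pos {α β : ℝ} (hα : 0 < α) (hβ : 0 < β) : 0 < freeCov d α β 0 0 := by
  simp only [freeCov, sub_self]
  exact mul_pos (inv_pos.2 hβ) (CetaM_zero_pos one_pos (pow_pos hα 2))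

/-- **«α, β … fixed so that the expectation of z_Δ² is ½» is satisfiable**: for every `α > 0` the choice
`β := 2·C¹_{α²}(0) > 0` gives `freeCov d α β 0 0 = ½`. [cite: BenfattoEtAl1978, (1.1) p.144] -/
theorem exists_beta_freeCov_eq_half {α : ℝ} (hα : 0 < α) : ∃ β : ℝ, 0 < β ∧ freeCov d α β 0 0 = 1 / 2 := by
  have hC : 0 < CetaM d 1 (α ^ 2) 0 := CetaM_zero_pos one_pos (pow_pos hα 2)
  refine ⟨2 * CetaM d 1 (α ^ 2) 0, by positivity, ?_⟩
  simp only [freeCov, sub_self]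
  field_simp

/-- **Non-vacuity of the discharged fact**: for `d = 2, 3` and every `α > 0` there is `β > 0` meeting the printed
normalisation `E z_Δ² = ½`, and (A.1)–(A.2) holds there — `AppendixALemmaPrinted_holds` quantifies over a nonempty range of
parameters. [cite: BenfattoEtAl1978, Appendix A Lemma (A.1)–(A.2) p.161] -/
theorem appendixALemmaPrinted_nonvacuous (hd : d = 2 ∨ d = 3) {α : ℝ} (hα : 0 < α) :
    ∃ β : ℝ, 0 < β ∧ freeCov d α β 0 0 = 1 / 2 ∧ AppendixALemma d α β := by
  obtain ⟨β, hβ, hhalf⟩ := exists_beta_freeCov_eq_half (d := d) hα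
  exact ⟨β, hβ, hhalf, appendixALemmaPrinted_holds d hd α β hα hβ hhalf⟩

end NonVacuity

end Literature.MathematicalPhysics.QuantumFieldTheory.Balaban1983to89.B1Eq324BenfattoAppendixA

end
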